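import Summits.ResolutionOfSingularities.ResolutionOfSingularities.Theorems.PurelyInseparableDim4PiPlateauOmegaMoveLawPow
import Summits.ResolutionOfSingularities.ResolutionOfSingularities.Theorems.PurelyInseparableDim4IsolatedOrderDichotomy
import Summits.ResolutionOfSingularities.ResolutionOfSingularities.Theorems.PurelyInseparableDim4Mode0Plateau
import Summits.ResolutionOfSingularities.ResolutionOfSingularities.Theorems.PurelyInseparableDim4PiPlateauLetters
import HarnessLib

/-!
# Ω along MODE-0 chains of the class `z^p + F(x₁, …, x₄)`: `ω_p` antitone, Moh's `e = 1` stability in literal letters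

[OURS · counted 0 · AI kernel work, weaker than expert review]  Nothing here is a statement about resolution of
singularities in dimension ≥ 4 / characteristic `p`, which is NOT proved.  Sequel of `…PiPlateauOmegaMoveLaw`
(`Plateau.omegaLetter_mode0_le`: `ω_p′ ≤ ω_p` on every MODE-0 edge from a clean `p`-fold state) read along the
`Step0 p` chains `c : ℕ → State K` of `…Target` (class `(4,1)`, every field of characteristic `p`, clean start `c 0`):

* `omegaLetter_succ_le_of_step0`, **`omegaLetter_antitone_of_step0`** — `ω_p(c k)` is ANTITONE in `k`;
* `residualOrder_succ_le_of_step0` — Moh's one-step bound `d_{k+1} ≤ d_k + 1` (literal `d = HauserPerlega.residualOrder`);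
* `residualOrder_no_consecutive_rise_of_step0` — rises are isolated (`d_{k+1} > d_k ⇒ d_{k+2} ≤ d_{k+1}`);
* **`residualOrder_le_add_one_of_step0`** — MOH'S STABILITY THEOREM (`e = 1`, sequence form) in literal letters for
  the cell's MODE-0 chains: `d_m ≤ d_n + 1` for all `n ≤ m` (from `d_m ≤ ω_m + 1 ≤ ω_n + 1 ≤ d_n + 1`), and
  `isVActive_of_residualOrder_eq_add_one`: at `d_m = d_n + 1` the state `c m` is `V_p`-active and `c n` is not;
* **`omegaLetter_eventually_const_of_step0`** + **`residualOrder_tail_of_step0`** — THE TAIL OF EVERY INFINITE MODE-0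
  BRANCH: `ω_p` is eventually constant `= w`, and from then on `d = w + [V_p]` — the residual order oscillates between
  `w` and `w + 1` exactly with the activity bit (cf. the C-001 umbrella chain `Mode0Umbrella`, letters `3, 2, 2, 3, …`);
* every `e` (`q = p^e`, over `…PiPlateauOmegaMoveLawPow`): `residualOrder_succ_le_add_pow_of_step0` (`d_{k+1} ≤ d_k +
  p^{e−1}`) and `omegaLetter_succ_le_add_of_step0` (`ω_{k+1} ≤ ω_k + [V_k = 0]·(p^{e−1} − 1)`) along `Step0 (p^e)` chains.

HONEST LABEL.  Moh's stability at `e = 1` is PRINT ([Moh1987] Stability Theorem; [Hauser2010] §F; the tree's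
bookkept-letter `PointBlowup.shade_le_shade_add_one_along` / `CentreBlowup.shade_le_shade_add_one_along`); what is
OURS is only the reading through the antitone letter `ω_p = d − [V_p]` (Π, res-dim4-idea-5 CARD I-5-5, p661587) in
the literal letters of `…PiPlateauStatement`.  A weakly monotone POINT letter: no strict decrease claimed (standing
no-go (C)); MODE 0 only (nothing for coordinate centres / MODE 1h); nothing about termination.  Typed and proved by
res-dim4-typ-1 (g2).  Supports stmt-ResolutionOfSingularities-16155 (helper).
bears_on: LADDER-RESOLUTION:D157-DOOR2 (res-dim4-pi · Π line · ω along chains).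
-/

set_option linter.dupNamespace false -- mandated namespace of this single-conjunct summit

namespace Summit.ResolutionOfSingularities.ResolutionOfSingularities.Theorems.PIDim4

namespace Plateau

open MvPolynomial Finset
open Literature.AlgebraicGeometry.Resolution
open Literature.AlgebraicGeometry.Resolution.Hauser2010
open Literature.AlgebraicGeometry.Resolution.CentreBlowup
open Literature.Barriers.ResolutionOfSingularities
open Literature.Barriers.ResolutionOfSingularities.HauserPerlega
open Summit.ResolutionOfSingularities.ResolutionOfSingularities.Theorems.Rescue.BedCylinderTransport
  (residualOrder_eq_ordZero_sub)

section Chains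

variable {K : Type} [Field K] [DecidableEq K]

/-- A clean start makes every state of the chain clean. [folklore] -/
theorem isClean_of_step0_chain (p : ℕ) {c : ℕ → State K} (hc : ∀ k, Step0 p (c k) (c (k + 1)))
    (h0 : IsClean p (c 0).F) (k : ℕ) : IsClean p (c k).F := by
  cases k with
  | zero => exact h0
  | succ k => exact IsolatedBand.isClean_of_step0 (hc k)

/-- **`ω_p` drops weakly at every MODE-0 step of the class** (`Step0 p` of `…Target`; `e = 1`), from a clean start.
[folklore] -/
theorem omegaLetter_succ_le_of_step0 (p : ℕ) [Fact p.Prime] [CharP K p] {c : ℕ → State K}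
    (hc : ∀ k, Step0 p (c k) (c (k + 1))) (h0 : IsClean p (c 0).F) (k : ℕ) :
    omegaLetter p (c (k + 1)).exc (c (k + 1)).F ≤ omegaLetter p (c k).exc (c k).F := by
  have hclean : IsClean p (c k).F := isClean_of_step0_chain p hc h0 k
  obtain ⟨hq, j, b, -, hbj, -, -, hck⟩ := hc k
  rw [ordAlong_univ] at hq
  rw [hck]
  exact omegaLetter_mode0_le p (c k) j b hbj hclean hq

/-- **`ω_p` IS ANTITONE ALONG EVERY MODE-0 CHAIN OF THE CLASS `z^p + F(x₁, …, x₄)`** (every field of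
characteristic `p`; clean start). [folklore] -/
theorem omegaLetter_antitone_of_step0 (p : ℕ) [Fact p.Prime] [CharP K p] {c : ℕ → State K}
    (hc : ∀ k, Step0 p (c k) (c (k + 1))) (h0 : IsClean p (c 0).F) :
    Antitone fun k => omegaLetter p (c k).exc (c k).F :=
  antitone_nat_of_succ_le fun k => omegaLetter_succ_le_of_step0 p hc h0 k

/-- **Moh's bound along the chain in literal letters** (`e = 1`): `d(c (k+1)) ≤ d(c k) + 1`. [cite: Moh1987, Stability Theorem] -/
theorem residualOrder_succ_le_of_step0 (p : ℕ) [Fact p.Prime] [CharP K p] {c : ℕ → State K}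
    (hc : ∀ k, Step0 p (c k) (c (k + 1))) (h0 : IsClean p (c 0).F) (k : ℕ) :
    residualOrder (c (k + 1)).exc (c (k + 1)).F ≤ residualOrder (c k).exc (c k).F + 1 := by
  have hclean : IsClean (p ^ 1) (c k).F := by rw [pow_one]; exact isClean_of_step0_chain p hc h0 k
  obtain ⟨hq, j, b, -, hbj, -, -, hck⟩ := hc k
  rw [ordAlong_univ] at hq
  have hq1 : ((p ^ 1 : ℕ) : ℕ∞) ≤ ordZero (c k).F := by rwa [pow_one]
  have h := residualOrder_step_le_add_pow p le_rfl (c k) j b hbj hclean hq1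
  simp only [pow_one, Nat.sub_self, pow_zero, Nat.cast_one] at h
  rw [hck]
  exact h

/-- **Rises are isolated along every MODE-0 chain of the class** (`e = 1`, literal letters): `d_{k+1} > d_k ⇒
d_{k+2} ≤ d_{k+1}`. [cite: Hauser2010, §G (kangaroo points)] -/
theorem residualOrder_no_consecutive_rise_of_step0 (p : ℕ) [Fact p.Prime] [CharP K p] {c : ℕ → State K}
    (hc : ∀ k, Step0 p (c k) (c (k + 1))) (h0 : IsClean p (c 0).F) (k : ℕ)
    (hlt : residualOrder (c k).exc (c k).F < residualOrder (c (k + 1)).exc (c (k + 1)).F) :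
    residualOrder (c (k + 2)).exc (c (k + 2)).F ≤ residualOrder (c (k + 1)).exc (c (k + 1)).F := by
  have hclean : IsClean p (c k).F := isClean_of_step0_chain p hc h0 k
  obtain ⟨hq, j, b, -, hbj, -, -, hck⟩ := hc k
  obtain ⟨hq', j', b', -, hbj', -, -, hck'⟩ := hc (k + 1)
  rw [ordAlong_univ] at hq hq'
  rw [hck] at hlt hq' hck'
  rw [hck', hck]
  exact residualOrder_step_step_le_of_lt p (c k) j b hbj hclean hq hlt j' b' hbj' hq'

/-- `d ≤ ω_p + 1` always, and `ω_p ≤ d`. [folklore] -/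
theorem residualOrder_le_omegaLetter_add_one {σ : Type*} {L : Type*} [Field L] (q : ℕ) (Δ : Finset σ)
    (F : MvPolynomial σ L) : residualOrder Δ F ≤ omegaLetter q Δ F + 1 ∧ omegaLetter q Δ F ≤ residualOrder Δ F := by
  unfold omegaLetter
  refine ⟨?_, tsub_le_self⟩
  split_ifs
  · exact le_tsub_add
  · rw [tsub_zero]; exact le_self_add

/-- **MOH'S STABILITY THEOREM (`e = 1`) IN LITERAL LETTERS along every MODE-0 chain of the class** (clean start,
every field of characteristic `p`): `d(c m) ≤ d(c n) + 1` for all `n ≤ m` — read off the antitone letter `ω_p`.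
[cite: Moh1987, Stability Theorem] [cite: Hauser2010, §F (shade′ ≤ shade + 1 until it drops)] -/
theorem residualOrder_le_add_one_of_step0 (p : ℕ) [Fact p.Prime] [CharP K p] {c : ℕ → State K}
    (hc : ∀ k, Step0 p (c k) (c (k + 1))) (h0 : IsClean p (c 0).F) {n m : ℕ} (hnm : n ≤ m) :
    residualOrder (c m).exc (c m).F ≤ residualOrder (c n).exc (c n).F + 1 := by
  have hω := omegaLetter_antitone_of_step0 p hc h0 hnm
  exact (residualOrder_le_omegaLetter_add_one p (c m).exc (c m).F).1.trans
    ((add_le_add hω le_rfl).trans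
      (add_le_add (residualOrder_le_omegaLetter_add_one p (c n).exc (c n).F).2 le_rfl))

/-- **The extremal case of Moh's stability**: if `d(c m) = d(c n) + 1` (`n ≤ m`, finite `d(c n)`), then `c m` is
`V_p`-ACTIVE and `c n` is `V_p`-INACTIVE (the `+1` is spent exactly on the activity bit of `ω_p`). [folklore] -/
theorem isVActive_of_residualOrder_eq_add_one (p : ℕ) [Fact p.Prime] [CharP K p] {c : ℕ → State K}
    (hc : ∀ k, Step0 p (c k) (c (k + 1))) (h0 : IsClean p (c 0).F) {n m : ℕ} (hnm : n ≤ m)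
    (hfin : residualOrder (c n).exc (c n).F ≠ ⊤)
    (heq : residualOrder (c m).exc (c m).F = residualOrder (c n).exc (c n).F + 1) :
    IsVActive p (c m).exc (c m).F ∧ ¬ IsVActive p (c n).exc (c n).F := by
  have hω := omegaLetter_antitone_of_step0 p hc h0 hnm
  simp only [omegaLetter] at hω
  rw [heq] at hω
  obtain ⟨d, hd⟩ := ENat.ne_top_iff_exists.mp hfin
  rw [← hd] at hω
  have h1 : (1 : ℕ∞) = ((1 : ℕ) : ℕ∞) := rfl
  have h0' : (0 : ℕ∞) = ((0 : ℕ) : ℕ∞) := rfl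
  constructor
  · by_contra hV
    rw [if_neg hV, tsub_zero] at hω
    have h := hω.trans tsub_le_self
    rw [h1, ← ENat.coe_add, Nat.cast_le] at h
    omega
  · intro hVn
    have hdn : (1 : ℕ∞) ≤ (d : ℕ∞) := hd ▸ one_le_residualOrder_of_isVActive p (c n).exc (c n).F hVn
    rw [if_pos hVn] at hω
    have h : (d : ℕ∞) + 1 - 1 ≤ (d : ℕ∞) - 1 := by
      refine le_trans ?_ hω
      split_ifs
      · exact le_rfl
      · rw [tsub_zero]; exact tsub_le_self
    rw [h1, ← ENat.coe_add, ← ENat.coe_sub, ← ENat.coe_sub, Nat.cast_le] at h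
    rw [h1, Nat.cast_le] at hdn
    omega

/-- **`ω_p` IS EVENTUALLY CONSTANT along every infinite MODE-0 chain of the class** (clean start): an antitone
`ℕ∞`-valued sequence stabilises. [folklore] -/
theorem omegaLetter_eventually_const_of_step0 (p : ℕ) [Fact p.Prime] [CharP K p] {c : ℕ → State K}
    (hc : ∀ k, Step0 p (c k) (c (k + 1))) (h0 : IsClean p (c 0).F) :
    ∃ N, ∀ k, N ≤ k → omegaLetter p (c k).exc (c k).F = omegaLetter p (c N).exc (c N).F := by
  obtain ⟨N, hN⟩ := WellFoundedLT.antitone_chain_condition (omegaLetter_antitone_of_step0 p hc h0)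
  exact ⟨N, fun k hk => (hN k hk).symm⟩

open Classical in
/-- `d = ω_p + [V_p]` (the activity bit is affordable: `d ≥ 1` on `V_p`-active states). [folklore] -/
theorem residualOrder_eq_omegaLetter_add {σ : Type*} [Fintype σ] [DecidableEq σ] {L : Type*} [Field L] (q : ℕ)
    (Δ : Finset σ) (F : MvPolynomial σ L) :
    residualOrder Δ F = omegaLetter q Δ F + (if IsVActive q Δ F then 1 else 0) := by
  unfold omegaLetter
  split_ifs with hV
  · exact (tsub_add_cancel_of_le (one_le_residualOrder_of_isVActive q Δ F hV)).symm
  · rw [tsub_zero, add_zero]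

open Classical in
/-- **THE TAIL OF EVERY INFINITE MODE-0 BRANCH** (class `(4,1)`, `e = 1`, clean start, every field of characteristic
`p`): there are an index `N` and a value `w` with `ω_p(c k) = w` and `d(c k) = w + [V_p(c k)]` for all `k ≥ N` — on the
tail the residual order takes only the values `w`, `w + 1`, and equals `w + 1` exactly at the `V_p`-active states.
[folklore] -/
theorem residualOrder_tail_of_step0 (p : ℕ) [Fact p.Prime] [CharP K p] {c : ℕ → State K}
    (hc : ∀ k, Step0 p (c k) (c (k + 1))) (h0 : IsClean p (c 0).F) :
    ∃ (N : ℕ) (w : ℕ∞), ∀ k, N ≤ k → omegaLetter p (c k).exc (c k).F = w ∧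
      residualOrder (c k).exc (c k).F = w + (if IsVActive p (c k).exc (c k).F then 1 else 0) := by
  obtain ⟨N, hN⟩ := omegaLetter_eventually_const_of_step0 p hc h0
  refine ⟨N, omegaLetter p (c N).exc (c N).F, fun k hk => ⟨hN k hk, ?_⟩⟩
  rw [← hN k hk]
  convert residualOrder_eq_omegaLetter_add p (c k).exc (c k).F

/-! ## Every exponent `q = p^e` -/

/-- **Moh's bound along `Step0 (p^e)` chains, literal letters**: `d_{k+1} ≤ d_k + p^{e−1}` (clean start, `e ≥ 1`).
[cite: Moh1987, Stability Theorem (one permissible blow-up)] -/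
theorem residualOrder_succ_le_add_pow_of_step0 (p : ℕ) [Fact p.Prime] [CharP K p] {e : ℕ} (he : 1 ≤ e)
    {c : ℕ → State K} (hc : ∀ k, Step0 (p ^ e) (c k) (c (k + 1))) (h0 : IsClean (p ^ e) (c 0).F) (k : ℕ) :
    residualOrder (c (k + 1)).exc (c (k + 1)).F ≤ residualOrder (c k).exc (c k).F + ((p ^ (e - 1) : ℕ) : ℕ∞) := by
  have hclean : IsClean (p ^ e) (c k).F := by
    cases k with
    | zero => exact h0
    | succ k => exact IsolatedBand.isClean_of_step0 (hc k)
  obtain ⟨hq, j, b, -, hbj, -, -, hck⟩ := hc k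
  rw [ordAlong_univ] at hq
  rw [hck]
  exact residualOrder_step_le_add_pow p he (c k) j b hbj hclean hq

open Classical in
/-- **The move law along `Step0 (p^e)` chains**: `ω_q(c (k+1)) ≤ ω_q(c k) + [V_q(c k) = 0]·(p^{e−1} − 1)` (clean
start, `e ≥ 1`). [folklore] -/
theorem omegaLetter_succ_le_add_of_step0 (p : ℕ) [Fact p.Prime] [CharP K p] {e : ℕ} (he : 1 ≤ e)
    {c : ℕ → State K} (hc : ∀ k, Step0 (p ^ e) (c k) (c (k + 1))) (h0 : IsClean (p ^ e) (c 0).F) (k : ℕ) :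
    omegaLetter (p ^ e) (c (k + 1)).exc (c (k + 1)).F ≤ omegaLetter (p ^ e) (c k).exc (c k).F +
      (if IsVActive (p ^ e) (c k).exc (c k).F then 0 else ((p ^ (e - 1) - 1 : ℕ) : ℕ∞)) := by
  have hclean : IsClean (p ^ e) (c k).F := by
    cases k with
    | zero => exact h0
    | succ k => exact IsolatedBand.isClean_of_step0 (hc k)
  obtain ⟨hq, j, b, -, hbj, -, -, hck⟩ := hc k
  rw [ordAlong_univ] at hq
  rw [hck]
  convert omegaLetter_move_law p he (c k) j b hbj hclean hq

/-! ## Appendix (append 1): `Step0 q` is never well-founded over a field -/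

/-- **`Step0 q` IS NOT WELL-FOUNDED over any field, for every `q ≥ 2`**: the tree's C-001 umbrella cylinder
(`PIDim4.exists_infinite_step0_chain`, module `…Mode0Plateau`) is an infinite MODE-0 chain.  So a K-GLOBAL hypothesis
`WellFounded (fun s' s => Step0 q s s')` is vacuous; termination is a property of the MODE-0 TREE OF ONE `F`
(`Acc` at its root states), never of the field. [folklore] -/
theorem not_wellFounded_step0 {q : ℕ} (hq : 2 ≤ q) : ¬ WellFounded (fun s' s : State K => Step0 q s s') := by
  intro hwf
  obtain ⟨c, hc⟩ := exists_infinite_step0_chain hq K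
  exact (wellFounded_iff_isEmpty_descending_chain.mp hwf).false ⟨c, hc⟩

/-- The same for `flip (Step0 q)` spelled with `flip`. [folklore] -/
theorem not_wellFounded_flip_step0 {q : ℕ} (hq : 2 ≤ q) : ¬ WellFounded (flip (Step0 (K := K) q)) :=
  not_wellFounded_step0 hq

/-! ## Appendix (append 2): the ROOT BOUND `d ≤ d_root` under MODE 0 from a `V_p`-active (e.g. `Δ = ∅`) root -/

/-- **`d_k ≤ d_0` along every `Step0 p` chain from a clean `V_p`-ACTIVE start** (`e = 1`): `ω_p` is antitone and
`ω_p(c 0) = d_0 − 1`, so `d_k ≤ ω_p(c k) + 1 ≤ ω_p(c 0) + 1 = d_0`.  (Moh's witness at the root: the residual order never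
exceeds its ROOT value — one better than CM₁'s `+ 1`.) [folklore] -/
theorem residualOrder_le_of_step0_of_isVActive (p : ℕ) [Fact p.Prime] [CharP K p] {c : ℕ → State K}
    (hc : ∀ k, Step0 p (c k) (c (k + 1))) (h0 : IsClean p (c 0).F) (hV : IsVActive p (c 0).exc (c 0).F) (k : ℕ) :
    residualOrder (c k).exc (c k).F ≤ residualOrder (c 0).exc (c 0).F := by
  have hω := omegaLetter_antitone_of_step0 p hc h0 (Nat.zero_le k)
  have h1 := (residualOrder_le_omegaLetter_add_one p (c k).exc (c k).F).1
  have hroot : omegaLetter p (c 0).exc (c 0).F + 1 = residualOrder (c 0).exc (c 0).F := by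
    unfold omegaLetter
    rw [if_pos hV]
    exact tsub_add_cancel_of_le (one_le_residualOrder_of_isVActive p (c 0).exc (c 0).F hV)
  calc residualOrder (c k).exc (c k).F ≤ omegaLetter p (c k).exc (c k).F + 1 := h1
    _ ≤ omegaLetter p (c 0).exc (c 0).F + 1 := add_le_add hω le_rfl
    _ = residualOrder (c 0).exc (c 0).F := hroot

/-- **A clean non-zero state with EMPTY exceptional set is `V_q`-active** (an initial monomial of a clean `F` is not
a `q`-th power, and every variable is non-exceptional). [folklore] -/
theorem isVActive_of_exc_empty {σ : Type*} {L : Type*} [Field L] (q : ℕ) {F : MvPolynomial σ L}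
    (hclean : IsClean q F) (hF0 : F ≠ 0) : IsVActive q (∅ : Finset σ) F := by
  obtain ⟨o, ho⟩ := exists_ordZero_eq_natCast hF0
  obtain ⟨⟨a, ha, hadeg⟩, -⟩ := (ordZero_eq_nat_iff _ _).mp ho
  have has : a ∈ F.support := MvPolynomial.mem_support_iff.mpr ha
  have hnp := hclean a has
  rw [isPthPowerExponent_iff] at hnp
  push Not at hnp
  obtain ⟨i, hi⟩ := hnp
  exact ⟨a, has, by rw [ho]; exact_mod_cast hadeg, i, Finset.notMem_empty i, hi⟩

/-- **THE ROOT BOUND (res-dim4-crit-2 T-B-07, point-centre half): along every MODE-0 chain of the class `(4,1)`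
from a clean non-zero root with `Δ = ∅`, the residual order NEVER EXCEEDS ITS ROOT VALUE `d_root = ord₀ F_root`**
(`e = 1`, every field of characteristic `p`, literal letters). [folklore] -/
theorem residualOrder_le_root_of_step0 (p : ℕ) [Fact p.Prime] [CharP K p] {c : ℕ → State K}
    (hc : ∀ k, Step0 p (c k) (c (k + 1))) (h0 : IsClean p (c 0).F) (hexc : (c 0).exc = ∅) (k : ℕ) :
    residualOrder (c k).exc (c k).F ≤ residualOrder (c 0).exc (c 0).F := by
  have hF0 : (c 0).F ≠ 0 := by
    intro h0e
    obtain ⟨-, j, b, -, -, -, hne, -⟩ := hc 0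
    apply hne
    show deletePthPowers p (PointBlowup.translate b (chartTransform p Finset.univ j (c 0).F)) = 0
    unfold chartTransform PointBlowup.translate
    rw [h0e, MvPolynomial.support_zero, Finset.sum_empty, map_zero, deletePthPowers_zero]
  have hV : IsVActive p (c 0).exc (c 0).F := by rw [hexc]; exact isVActive_of_exc_empty p h0 hF0
  exact residualOrder_le_of_step0_of_isVActive p hc h0 hV k

/-- The same bound in the ENGINES' letters (`CState.shade`), for a root `(F, 0, ∅)`: `shade (c k) ≤ shade (c 0) = ord₀ F`.
[folklore] -/
theorem shade_le_root_of_step0 (p : ℕ) [Fact p.Prime] [CharP K p] {c : ℕ → State K}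
    (hc : ∀ k, Step0 p (c k) (c (k + 1))) (h0 : IsClean p (c 0).F) (hexc : (c 0).exc = ∅) (hr : (c 0).r = 0)
    (k : ℕ) : (c k).shade ≤ (c 0).shade := by
  have hcons : (c 0).r = exceptionalExp (c 0).exc (c 0).F := by
    rw [hr, hexc]
    unfold exceptionalExp
    rw [Finset.sum_empty]
  have hc1 : ∀ k, Step0 (p ^ 1) (c k) (c (k + 1)) := by rw [pow_one]; exact hc
  have h01 : IsClean (p ^ 1) (c 0).F := by rw [pow_one]; exact h0
  rw [shade_eq_residualOrder_of_step0 p 1 hc1 h01 hcons k, shade_eq_residualOrder_of_step0 p 1 hc1 h01 hcons 0]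
  exact residualOrder_le_root_of_step0 p hc h0 hexc k

end Chains

end Plateau

end Summit.ResolutionOfSingularities.ResolutionOfSingularities.Theorems.PIDim4
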